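import Literature.AlgebraicGeometry.Frobenioids.Cor411iiBiratApexSetting
import Literature.AlgebraicGeometry.Frobenioids.DivisorMonoidCategoryTheoreticityCorProofsII
import Literature.AlgebraicGeometry.Frobenioids.DivisorMonoidCategoryTheoreticityCorProofsIV
import Literature.AlgebraicGeometry.Frobenioids.DivisorMonoidCategoryTheoreticityCorProofsV
import Literature.AlgebraicGeometry.Frobenioids.BirationalizationFrobenioidGeneral
import Literature.AlgebraicGeometry.Frobenioids.Thm49CompatAssembly
import HarnessLib

/-!
# Frobenioids I, Corollary 4.11 (iii) and (iv) AS TYPED over the setting of the proof of Theorem 4.2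

Mochizuki, *The geometry of Frobenioids I: the general theory*, Kyushu J. Math. **62** (2008)
293–400, kurims text: Cor. 4.11 (iii), (iv) statement p. 92 ll. 8–32; proof p. 94 ll. 8–32: "assertion
(iii) follows formally from assertion (ii); Theorem 4.9 [cf. also Definition 1.3, (i), (a), (b); the
technique of constructing '`D^* → D`' …]. Finally, we consider assertion (iv). In light of the structure of
an elementary Frobenioid [cf. Definition 1.1, (iii)], the existence of a 1-commutative diagram as in the
statement of assertion (iv) now follows simply by concatenating assertions (ii), (iii), with the fact that
`Ψ` preserves Frobenius degrees [cf. Theorem 3.4, (iii)]. The fact that the composite functors in this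
diagram are rigid follows via the same argument as the argument applied to prove rigidity in the proof of
assertion (i)" [cite: MochizukiFrdI2008, Cor. 4.11 (iv) p.94].

PROOF-ONLY file (seat abc-iut-L1-t14, rows `FrdI:Cor4.11(iii)`, `FrdI:Cor4.11(iv)` of the cell's
discharge board; sub-DAG `plan/L1/SUBDAG-FrdI-Cor411.md` rows L18–L20 and (iv)). Everything is assembled
BY NAME from landed pieces, over `FrdI.T42.Setting F₁ F₂ Ψ` — the setting of the proof of Thm. 4.2 after
its reductions ("we may assume without loss of generality that `C₁, C₂` are of isotropic type … not of
group-like type", p. 92; "by passing to perfections", pp. 78, 89): Frobenioids of perfect and isotropic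
type, `Φ_i` perf-factorial, the conclusions of Thm. 3.4 (ii)(iii) for `Ψ`, `Ψ⁻¹`:

* `PreFrobenioidData.DivisorMonoidIsoOver.iso_div_of_preSteps` — the one new lemma: an isomorphism of functors
  `Ψ^Φ : Φ₁ ⥲ Φ₂` over `Ψ` that computes `Div(Ψ φ) = Ψ^Φ_A(Div φ)` on PRE-STEPS does so on ALL arrows,
  by the factorisation "pull-back ∘ pre-step ∘ Frobenius-type" of Def. 1.3 (iv)(a) and Rem. 1.1.1
  (`Div(ψ ∘ φ) = Base(φ)^* Div(ψ) + deg_Fr(ψ)·Div(φ)`; arrows of Frobenius type and pull-back morphisms are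
  isometries, Def. 1.2 (iii), Def. 1.3 (iv)(b)), given that `Ψ` preserves arrows of Frobenius type and
  pull-back morphisms (Thm. 3.4 (iii));
* `FrdI.T42.cor411iii_inst_of_setting` — the typed `(ofFunctor Φ₁ F₁).Cor411iii (ofFunctor Φ₂ F₂) Ψ R₁ R₂`:
  Cor. 4.11 (ii) over the setting (`FrdI.T42.cor411ii_inst_of_setting`, seat abc-iut-L1-d6; its base data —
  FSMFF, non-dilating, Div-slim — read off the antecedent `Cor411Setting`, its "`C_i^birat` is a
  Frobenioid" from "birationally Frobenius-normalized type" = Def. 4.5 (iii)(a) by Prop. 4.4 (ii) in the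
  author's 2024 form, `PreFrobenioid.Birat.isFrobenioid_general`, seat abc-iut-L6-t20, its "`Ψ^{±1}`
  preserve primary pre-steps" = Thm. 4.2 (i) `Setting.isPrimaryPreStep_map/_inverse_map`, seats
  abc-iut-w4-d099), Thm. 4.9 over the setting (`FrdI.T49.exists_thm49_compat_perfect`, seat abc-iut-w4-d099
  assembling rows T49-L02…L08 of seats abc-iut-w4-d035, abc-iut-w4-d105, abc-iut-w4-d109, abc-iut-w5-d021) and the descent `D^* ⥲ D`
  (`PreFrobenioidData.cor411iii_of_cor411ii_of_thm49`, seat abc-iut-L1-d6);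
* `FrdI.T42.exists_cor411iii_compat_of_setting` — (iii) WITH its compatibility clause `Cor411iii_compat`
  ("compatible … with the isomorphism `Ψ^Prime` of Theorem 4.2, (ii)", p. 92): THE `Ψ^Prime`, the `Ψ^Φ` of
  Thm. 4.9 with `Thm49_compat`, and bijections of primes over `Ψ^Base` induced by `Ψ^Prime` for the descended
  `Ψ^Φ'` (`PreFrobenioidData.DivisorMonoidIsoOver.exists_primes_compat_overBase`, the second new lemma:
  transport along the pull-back isomorphisms `Φ₁(X) ≅ Φ₁(Base A)`, `Prime(−)` functorial in isomorphisms);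
* `FrdI.T42.exists_cor411iv_data_of_setting` / `FrdI.T42.cor411iv_inst_of_setting` — THE data of (iv)
  (`Ψ^Base`, `η`, `Ψ^Φ` on `D₁`, the Div formula on all arrows, `Ψ` preserves Frobenius degrees) together
  with print's rigidity clause `Cor411ivRigid` for it (`PreFrobenioid.cor411ivRigid_of_square`, seat
  abc-iut-L1-d6), and the typed `(ofFunctor Φ₁ F₁).Cor411iv (ofFunctor Φ₂ F₂) Ψ R₁ R₂`
  (`PreFrobenioidData.cor411iv_of_cor411ii`, seat abc-iut-L1-d6).

Residual hypotheses, all printed: the setting; "birationally Frobenius-normalized type" (Def. 4.5 (iii)(a));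
a support predicate with the support axiom of Def. 2.4 (i)(d); "every universally Div-Frobenius-trivial
object is rational" at THE birationalization (Def. 4.5 (ii)(iii)). The parameters `R_i : RSParams` of the
typed predicates are arbitrary (their antecedent `IsOfRationallyStandardType R_i` is not used: rationality
enters through `hrat` at THE birationalization). No new definitions; nothing of the paper is restated;
nothing here is specific to the abc programme and no side is taken on [IUTchIII] Cor. 3.12.
-/

namespace Literature.AlgebraicGeometry.Frobenioids

open CategoryTheory Opposite

universe w v v' u u'

namespace PreFrobenioidData

section Descent

universe w₁ w₂ v₁ v₁' v₂ v₂' u₁ u₁' u₂ u₂'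

variable {C₁ : Type u₁} [Category.{v₁} C₁] {D₁ : Type u₁'} [Category.{v₁'} D₁]
variable {C₂ : Type u₂} [Category.{v₂} C₂] {D₂ : Type u₂'} [Category.{v₂'} D₂]
variable {S₁ : PreFrobenioidData.{w₁} C₁ D₁} {S₂ : PreFrobenioidData.{w₂} C₂ D₂} {Ψ : C₁ ≌ C₂}

/-- **Descent of the `Ψ^Prime`-compatibility of `Ψ^Φ` from `C` to `D`** (the clause "compatible with the
isomorphism `Ψ^Prime` of Theorem 4.2, (ii)" of Cor. 4.11 (iii), p. 92, carried along the descent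
`D^* ⥲ D` of its proof, p. 94): if `Ψ^Φ` over `Ψ` maps `Φ₁(A)_𝔭` onto `Φ₂(Ψ A)_{e_A(𝔭)}` for a family of
bijections of primes `e` (`Thm49_compat`), and `Ψ^Φ'` on `D₁` over `Ψ^Base` is its descent (at `Base A` it
is `Ψ^Φ_A` followed by `(η_A⁻¹)^*`), then — every object of `D₁` being isomorphic to some `Base A`
(Def. 1.3 (i)(a)) — there is a family of bijections `e'_X : Prime(Φ₁(X)) ≅ Prime(Φ₂(Ψ^Base X))`, namely `e_A`
at a chosen `A` with `Base A ≅ X` transported along the pull-back isomorphisms, for which `Ψ^Φ'_X` maps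
`Φ₁(X)_𝔭` onto `Φ₂(Ψ^Base X)_{e'_X(𝔭)}`. [cite: MochizukiFrdI2008, Cor. 4.11 (iii) p.92] -/
theorem DivisorMonoidIsoOver.exists_primes_compat_overBase (E : DivisorMonoidIsoOver S₁ S₂ Ψ)
    (e : ∀ A : C₁, Primes (S₁.Mon (S₁.base.obj A)) ≃ Primes (S₂.Mon (S₂.base.obj (Ψ.functor.obj A))))
    (ΨBase : D₁ ⥤ D₂) (η : Ψ.functor ⋙ S₂.base ≅ S₁.base ⋙ ΨBase) (E' : DivisorMonoidIsoOverBase S₁ S₂ ΨBase)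
    (hE' : ∀ (A : C₁) (x : S₁.Mon (S₁.base.obj A)),
      E'.iso (S₁.base.obj A) x = S₂.pull (η.inv.app A) (E.iso A x))
    (hbase : ∀ X : D₁, ∃ A : C₁, Nonempty (S₁.base.obj A ≅ X)) :
    ∃ e' : ∀ X : D₁, Primes (S₁.Mon X) ≃ Primes (S₂.Mon (ΨBase.obj X)),
      (∀ (A : C₁) (𝔭 : Primes (S₁.Mon (S₁.base.obj A))) (x : S₁.Mon (S₁.base.obj A)),
          x ∈ 𝔭.submonoid ↔ E.iso A x ∈ (e A 𝔭).submonoid) →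
        ∀ (X : D₁) (𝔭 : Primes (S₁.Mon X)) (x : S₁.Mon X),
          x ∈ 𝔭.submonoid ↔ E'.iso X x ∈ (e' X 𝔭).submonoid := by
  classical
  choose A hA using hbase
  have i : ∀ X : D₁, S₁.base.obj (A X) ≅ X := fun X => (hA X).some
  -- pull-back along `i X` and along `j X : Ψ^Base X ≅ Base₂ Ψ (A X)` as isomorphisms of monoids
  choose m₁ hm₁ using fun X : D₁ => S₁.exists_pull_mulEquiv (i X)
  let j : ∀ X : D₁, ΨBase.obj X ≅ S₂.base.obj (Ψ.functor.obj (A X)) := fun X =>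
    ΨBase.mapIso (i X).symm ≪≫ (η.app (A X)).symm
  have hj : ∀ X, (j X).hom = ΨBase.map (i X).inv ≫ η.inv.app (A X) := fun X => rfl
  choose n₂ hn₂ using fun X : D₁ => S₂.exists_pull_mulEquiv (j X)
  refine ⟨fun X => (Primes.congr (m₁ X)).trans ((e (A X)).trans (Primes.congr (n₂ X))), fun hcomp X 𝔭 x => ?_⟩
  -- `Ψ^Φ'_X = (j X)^* ∘ Ψ^Φ_{A X} ∘ (i X)^*`
  have hx : E'.iso X x = n₂ X (E.iso (A X) (m₁ X x)) := by
    rw [hn₂, hm₁, hj]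
    have h1 := E'.natural (i X).hom x
    rw [hE'] at h1
    refine S₂.pull_eq_of_pull_eq_of_comp_eq_id (ΨBase.map (i X).hom) (η.inv.app (A X)) (ΨBase.map (i X).inv)
      ?_ _ _ h1.symm
    rw [← ΨBase.map_comp, Iso.inv_hom_id, ΨBase.map_id]
  rw [hx, Equiv.trans_apply, Equiv.trans_apply, Primes.mem_submonoid_congr_iff, MulEquiv.symm_apply_apply,
    ← hcomp, Primes.mem_submonoid_congr_iff, MulEquiv.symm_apply_apply]

end Descent

end PreFrobenioidData

namespace PreFrobenioid

variable {D₁ : Type u} [Category.{v} D₁] {Φ₁ : D₁ᵒᵖ ⥤ CommMonCat.{w}} {C₁ : Type u'} [Category.{v'} C₁]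
  {D₂ : Type u} [Category.{v} D₂] {Φ₂ : D₂ᵒᵖ ⥤ CommMonCat.{w}} {C₂ : Type u'} [Category.{v'} C₂]
  {F₁ : C₁ ⥤ ElemFrobenioid Φ₁} {F₂ : C₂ ⥤ ElemFrobenioid Φ₂}

/-- In a Frobenioid, the zero divisor of an arrow written as "pull-back ∘ pre-step ∘ Frobenius-type",
`φ = α ∘ β ∘ γ` (Def. 1.3 (iv)(a)), is `Base(γ)^* Div(β)`: arrows of Frobenius type and pull-back morphisms
are isometries (Def. 1.2 (iii); Def. 1.3 (iv)(b)), pull-back morphisms are linear, and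
`Div(ψ ∘ φ) = Base(φ)^* Div(ψ) + deg_Fr(ψ)·Div(φ)` (Rem. 1.1.1). [cite: MochizukiFrdI2008, Def. 1.3 (iv) p.24] -/
theorem div_eq_pull_div_of_factorisation (hF : IsFrobenioid F₁) {A X Y B : C₁} (γ : A ⟶ X) (β : X ⟶ Y)
    (α : Y ⟶ B) (hγ : IsFrobeniusType F₁ γ) (hα : IsPullbackMorphism F₁ α) :
    Div F₁ (γ ≫ β ≫ α) = pull Φ₁ (Base F₁ γ) (Div F₁ β) := by
  have hα' := hF.iv_b α hα
  rw [div_comp, div_comp, show Div F₁ α = 1 from hα'.1.2, map_one, one_mul,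
    show degFr F₁ α = 1 from hα'.2, PNat.one_coe, pow_one, show Div F₁ γ = 1 from hγ.1.2, one_pow,
    mul_one]

set_option backward.isDefEq.respectTransparency false in
/-- **An isomorphism of functors `Ψ^Φ : Φ₁ ⥲ Φ₂` over `Ψ` computing `Div(Ψ φ) = Ψ^Φ(Div φ)` on pre-steps
computes it on all arrows** — for Frobenioids `C_i → F_{Φ_i}` and `Ψ` preserving arrows of Frobenius type
and pull-back morphisms (Thm. 3.4 (iii)): write `φ = α ∘ β ∘ γ` (Def. 1.3 (iv)(a)); then
`Div φ = Base(γ)^* Div β`, `Div(Ψ φ) = Base(Ψ γ)^* Div(Ψ β)`, and `Ψ^Φ` is natural along `γ`. This is the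
"Div-compatibility" of the `Ψ^Φ` of Thm. 4.9 used in Cor. 4.11 (iv) ("`Ψ^F ∘ (C₁ → F_{Φ₁}) ≅ (C₂ → F_{Φ₂}) ∘ Ψ`",
p. 92). [cite: MochizukiFrdI2008, Cor. 4.11 (iv) p.92] -/
theorem _root_.Literature.AlgebraicGeometry.Frobenioids.PreFrobenioidData.DivisorMonoidIsoOver.iso_div_of_preSteps
    (hF₁ : IsFrobenioid F₁) (hF₂ : IsFrobenioid F₂) {Ψ : C₁ ≌ C₂}
    (hft : ∀ ⦃X Y : C₁⦄ (φ : X ⟶ Y), IsFrobeniusType F₁ φ → IsFrobeniusType F₂ (Ψ.functor.map φ))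
    (hpb : ∀ ⦃X Y : C₁⦄ (φ : X ⟶ Y), IsPullbackMorphism F₁ φ → IsPullbackMorphism F₂ (Ψ.functor.map φ))
    (E : (PreFrobenioidData.ofFunctor Φ₁ F₁).DivisorMonoidIsoOver (PreFrobenioidData.ofFunctor Φ₂ F₂) Ψ)
    (hE : ∀ ⦃A B : C₁⦄ (φ : A ⟶ B), IsPreStep F₁ φ → E.iso A (Div F₁ φ) = Div F₂ (Ψ.functor.map φ))
    ⦃A B : C₁⦄ (φ : A ⟶ B) : E.iso A (Div F₁ φ) = Div F₂ (Ψ.functor.map φ) := by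
  obtain ⟨X, Y, γ, β, α, hφ, hγ, hβ, hα⟩ := hF₁.iv_a_exists φ
  have h1 : Div F₁ φ = pull Φ₁ (Base F₁ γ) (Div F₁ β) := by
    rw [← hφ]
    exact div_eq_pull_div_of_factorisation hF₁ γ β α hγ hα
  have h2 : Div F₂ (Ψ.functor.map φ) = pull Φ₂ (Base F₂ (Ψ.functor.map γ)) (Div F₂ (Ψ.functor.map β)) := by
    rw [← hφ, Functor.map_comp, Functor.map_comp]
    exact div_eq_pull_div_of_factorisation hF₂ _ _ _ (hft γ hγ) (hpb α hα)
  rw [h1, h2, ← hE β hβ]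
  exact E.natural γ (Div F₁ β)

end PreFrobenioid

namespace FrdI.T42

open PreFrobenioid

variable {D₁ : Type u} [Category.{v} D₁] {Φ₁ : D₁ᵒᵖ ⥤ CommMonCat.{w}} {C₁ : Type u'} [Category.{v'} C₁]
  {D₂ : Type u} [Category.{v} D₂] {Φ₂ : D₂ᵒᵖ ⥤ CommMonCat.{w}} {C₂ : Type u'} [Category.{v'} C₂]
  {F₁ : C₁ ⥤ ElemFrobenioid Φ₁} {F₂ : C₂ ⥤ ElemFrobenioid Φ₂} {Ψ : C₁ ≌ C₂}

set_option backward.isDefEq.respectTransparency false in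
/-- **[FrdI] Cor. 4.11 (ii) over `FrdI.T42.Setting` with the base data read off `Cor411Setting`** (seat
abc-iut-L1-d6's `cor411ii_inst_of_setting` with its residual inputs discharged BY NAME): "`C_i^birat` is a
Frobenioid" from "`C_i` of birationally Frobenius-normalized type" (Def. 4.5 (iii)(a); Prop. 4.4 (ii), 2024
form: `PreFrobenioid.Birat.isFrobenioid_general`), the squares of Prop. 1.11 (vii)
(`hasBiratSquares_of_isFrobenioid`), FSMFF / non-dilating / Div-slim from `Cor411Setting`, and "`Ψ^{±1}`
preserve primary pre-steps" (Thm. 4.2 (i): `Setting.isPrimaryPreStep_map`, `…_inverse_map`).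
[cite: MochizukiFrdI2008, Cor. 4.11 (ii) p.91] -/
theorem exists_baseSquare_of_setting (S : Setting F₁ F₂ Ψ)
    (hbfn₁ : ∀ A : C₁, IsBiratFrobeniusNormalized F₁ S.isFrobenioid₁
      (hasBiratSquares_of_isFrobenioid S.isFrobenioid₁) A)
    (hbfn₂ : ∀ A : C₂, IsBiratFrobeniusNormalized F₂ S.isFrobenioid₂
      (hasBiratSquares_of_isFrobenioid S.isFrobenioid₂) A)
    (hs : (PreFrobenioidData.ofFunctor Φ₁ F₁).Cor411Setting (PreFrobenioidData.ofFunctor Φ₂ F₂) Ψ) :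
    ∃ ΨBase : D₁ ⥤ D₂, PreFrobenioidData.OneUniqueSquare Ψ.functor (PreFrobenioidData.ofFunctor Φ₁ F₁).base
      (PreFrobenioidData.ofFunctor Φ₂ F₂).base ΨBase ∧
      (IsSlim D₁ → IsSlim D₂ → IsRigidFunctor (Ψ.functor ⋙ (PreFrobenioidData.ofFunctor Φ₂ F₂).base) ∧
        IsRigidFunctor ((PreFrobenioidData.ofFunctor Φ₁ F₁).base ⋙ ΨBase)) :=
  cor411ii_inst_of_setting S _ _
    (Birat.isFrobenioid_general S.isFrobenioid₁ _ hbfn₁) (Birat.isFrobenioid_general S.isFrobenioid₂ _ hbfn₂)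
    hs.standard.1.fsmff hs.standard.2.fsmff (isNonDilatingOn_of_ofFunctor hs.standard.1.nonDilating)
    (isNonDilatingOn_of_ofFunctor hs.standard.2.nonDilating) hs.divSlim.1 hs.divSlim.2
    (fun _ _ _ hφ => S.isPrimaryPreStep_map hφ) (fun _ _ _ hφ => S.isPrimaryPreStep_inverse_map hφ) hs

set_option backward.isDefEq.respectTransparency false in
/-- **[FrdI] Cor. 4.11 (iii) AS TYPED over `FrdI.T42.Setting`** ("assertion (iii) follows formally from
assertion (ii); Theorem 4.9", p. 94): for Frobenioids `C_i → F_{Φ_i}` in the setting of the proof of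
Thm. 4.2 (perfect and isotropic type, `Φ_i` perf-factorial, Thm. 3.4 (ii)(iii) for `Ψ^{±1}`), of birationally
Frobenius-normalized type (Def. 4.5 (iii)(a)), with a support predicate obeying Def. 2.4 (i)(d) and every
universally Div-Frobenius-trivial object of `C₁` rational at THE birationalization (Def. 4.5 (ii)(iii)), the
typed `Cor411iii` holds: under `Cor411Setting` there are THE `1`-unique `Ψ^Base` of (ii) and an isomorphism
of functors `Ψ^Φ : Φ₁ ⥲ Φ₂` ON THE BASE CATEGORIES lying over `Ψ^Base` (Thm. 4.9 over `Ψ`, descended along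
`D^* ⥲ D`). The parameters `R_i` are arbitrary. [cite: MochizukiFrdI2008, Cor. 4.11 (iii) p.92] -/
theorem cor411iii_inst_of_setting (S : Setting F₁ F₂ Ψ)
    (hbfn₁ : ∀ A : C₁, IsBiratFrobeniusNormalized F₁ S.isFrobenioid₁
      (hasBiratSquares_of_isFrobenioid S.isFrobenioid₁) A)
    (hbfn₂ : ∀ A : C₂, IsBiratFrobeniusNormalized F₂ S.isFrobenioid₂
      (hasBiratSquares_of_isFrobenioid S.isFrobenioid₂) A)
    (Supp : ∀ {X : D₁}, (PreFrobenioidData.ofFunctor Φ₁ F₁).Mon X →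
      Primes ((PreFrobenioidData.ofFunctor Φ₁ F₁).Mon X) → Prop)
    (hSupp : ∀ (X : D₁) (a : Φ₁.obj (op X)) (𝔭 : Primes (Φ₁.obj (op X))),
      Supp a 𝔭 ↔ ∃ (a₀ : Φ₁.obj (op X)) (h₀ : IsPrimary a₀),
        Quotient.mk (primarySetoid _) ⟨a₀, h₀⟩ = 𝔭 ∧ Precsim a₀ a)
    (hrat : ∀ ⦃A : C₁⦄, PreFrobenioid.IsUniversallyDivFrobeniusTrivial F₁ A →
      PreFrobenioidData.IsRational (PreFrobenioid.biratData S.isFrobenioid₁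
        (PreFrobenioid.hasBiratSquares_of_isFrobenioid S.isFrobenioid₁)) Supp A)
    (R₁ : (PreFrobenioidData.ofFunctor Φ₁ F₁).RSParams) (R₂ : (PreFrobenioidData.ofFunctor Φ₂ F₂).RSParams) :
    (PreFrobenioidData.ofFunctor Φ₁ F₁).Cor411iii (PreFrobenioidData.ofFunctor Φ₂ F₂) Ψ R₁ R₂ := by
  intro hs hR₁ hR₂
  obtain ⟨E, e, -, -, -⟩ := FrdI.T49.exists_thm49_compat_perfect S
    (isNonDilatingOn_of_ofFunctor hs.standard.2.nonDilating) Supp hSupp hrat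
  exact PreFrobenioidData.cor411iii_of_cor411ii_of_thm49 _ _ Ψ R₁ R₂
    (exists_base_iso_of_isFrobenioid F₁ S.isFrobenioid₁) (exists_preSteps_of_base_iso F₁ S.isFrobenioid₁)
    (fun A _ f => exists_arrow_over_base F₁ S.isFrobenioid₁ A f)
    (fun hs' => exists_baseSquare_of_setting S hbfn₁ hbfn₂ hs') (fun _ _ => ⟨E⟩) hs hR₁ hR₂

set_option backward.isDefEq.respectTransparency false in
/-- **[FrdI] Cor. 4.11 (iii) over `FrdI.T42.Setting`, WITH its compatibility clause** ("compatible [when the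
`C_i` are of isotropic, but not of group-like type] with the isomorphism `Ψ^Prime` of Theorem 4.2, (ii)",
p. 92; typed `Cor411iii_compat`): under the hypotheses of `cor411iii_inst_of_setting` and `Cor411Setting`
there are THE `Ψ^Prime = e` of Thm. 4.2 (ii) (clauses (a), (b) on co-angular pre-steps out of / into each
`A`), the `Ψ^Φ : Φ₁ ⥲ Φ₂` over `Ψ` of Thm. 4.9 with its compatibility clause `Thm49_compat` relative to `e`,
the `1`-unique `Ψ^Base` of (ii) with `η : Base₂ ∘ Ψ ≅ Ψ^Base ∘ Base₁`, the descended `Ψ^Φ'` on `D₁` over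
`Ψ^Base` (at `Base A`: `Ψ^Φ_A` followed by `(η_A⁻¹)^*`), and bijections of primes `e'` over `Ψ^Base` induced
by `e` for which the typed `Cor411iii_compat Ψ^Φ' e'` holds. [cite: MochizukiFrdI2008, Cor. 4.11 (iii) p.92] -/
theorem exists_cor411iii_compat_of_setting (S : Setting F₁ F₂ Ψ)
    (hbfn₁ : ∀ A : C₁, IsBiratFrobeniusNormalized F₁ S.isFrobenioid₁
      (hasBiratSquares_of_isFrobenioid S.isFrobenioid₁) A)
    (hbfn₂ : ∀ A : C₂, IsBiratFrobeniusNormalized F₂ S.isFrobenioid₂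
      (hasBiratSquares_of_isFrobenioid S.isFrobenioid₂) A)
    (Supp : ∀ {X : D₁}, (PreFrobenioidData.ofFunctor Φ₁ F₁).Mon X →
      Primes ((PreFrobenioidData.ofFunctor Φ₁ F₁).Mon X) → Prop)
    (hSupp : ∀ (X : D₁) (a : Φ₁.obj (op X)) (𝔭 : Primes (Φ₁.obj (op X))),
      Supp a 𝔭 ↔ ∃ (a₀ : Φ₁.obj (op X)) (h₀ : IsPrimary a₀),
        Quotient.mk (primarySetoid _) ⟨a₀, h₀⟩ = 𝔭 ∧ Precsim a₀ a)
    (hrat : ∀ ⦃A : C₁⦄, PreFrobenioid.IsUniversallyDivFrobeniusTrivial F₁ A →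
      PreFrobenioidData.IsRational (PreFrobenioid.biratData S.isFrobenioid₁
        (PreFrobenioid.hasBiratSquares_of_isFrobenioid S.isFrobenioid₁)) Supp A)
    (hs : (PreFrobenioidData.ofFunctor Φ₁ F₁).Cor411Setting (PreFrobenioidData.ofFunctor Φ₂ F₂) Ψ) :
    ∃ (e : ∀ A : C₁, Primes (Φ₁.obj (op (baseObj F₁ A))) ≃ Primes (Φ₂.obj (op (baseObj F₂ (Ψ.functor.obj A)))))
      (E : (PreFrobenioidData.ofFunctor Φ₁ F₁).DivisorMonoidIsoOver (PreFrobenioidData.ofFunctor Φ₂ F₂) Ψ)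
      (ΨBase : D₁ ⥤ D₂)
      (η : Ψ.functor ⋙ (PreFrobenioidData.ofFunctor Φ₂ F₂).base ≅ (PreFrobenioidData.ofFunctor Φ₁ F₁).base ⋙ ΨBase)
      (E' : (PreFrobenioidData.ofFunctor Φ₁ F₁).DivisorMonoidIsoOverBase (PreFrobenioidData.ofFunctor Φ₂ F₂) ΨBase)
      (e' : ∀ X : D₁, Primes (Φ₁.obj (op X)) ≃ Primes (Φ₂.obj (op (ΨBase.obj X)))),
      (∀ (A : C₁) (𝔭 : Primes (Φ₁.obj (op (baseObj F₁ A)))),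
        (∀ ⦃B : C₁⦄ (φ : A ⟶ B), IsCoAngularPreStep F₁ φ →
            (Div F₁ φ ∈ 𝔭.submonoid ↔ Div F₂ (Ψ.functor.map φ) ∈ (e A 𝔭).submonoid)) ∧
        ∀ ⦃B : C₁⦄ (ψ : B ⟶ A), IsCoAngularPreStep F₁ ψ →
          ((∃ y ∈ 𝔭.submonoid, pull Φ₁ (Base F₁ ψ) y = Div F₁ ψ) ↔
            ∃ y ∈ (e A 𝔭).submonoid, pull Φ₂ (Base F₂ (Ψ.functor.map ψ)) y = Div F₂ (Ψ.functor.map ψ))) ∧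
      (PreFrobenioidData.ofFunctor Φ₁ F₁).Thm49_compat (PreFrobenioidData.ofFunctor Φ₂ F₂) Ψ E e ∧
      PreFrobenioidData.OneUniqueSquare Ψ.functor (PreFrobenioidData.ofFunctor Φ₁ F₁).base
        (PreFrobenioidData.ofFunctor Φ₂ F₂).base ΨBase ∧
      (∀ (A : C₁) (x : Φ₁.obj (op (baseObj F₁ A))), E'.iso (baseObj F₁ A) x = pull Φ₂ (η.inv.app A) (E.iso A x)) ∧
      (PreFrobenioidData.ofFunctor Φ₁ F₁).Cor411iii_compat (PreFrobenioidData.ofFunctor Φ₂ F₂) E' e' := by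
  obtain ⟨ΨBase, hsq, -⟩ := exists_baseSquare_of_setting S hbfn₁ hbfn₂ hs
  obtain ⟨η⟩ := hsq.2.1
  obtain ⟨E, e, he, -, hcompat⟩ := FrdI.T49.exists_thm49_compat_perfect S
    (isNonDilatingOn_of_ofFunctor hs.standard.2.nonDilating) Supp hSupp hrat
  obtain ⟨E', hE'⟩ := E.exists_overBase ΨBase η (exists_base_iso_of_isFrobenioid F₁ S.isFrobenioid₁)
    (exists_preSteps_of_base_iso F₁ S.isFrobenioid₁) (fun A _ f => exists_arrow_over_base F₁ S.isFrobenioid₁ A f)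
  obtain ⟨e', he'⟩ := E.exists_primes_compat_overBase e ΨBase η E' hE'
    (exists_base_iso_of_isFrobenioid F₁ S.isFrobenioid₁)
  exact ⟨e, E, ΨBase, η, E', e', he, hcompat, hsq, hE',
    fun h₁ h₂ h₃ h₄ X 𝔭 x => he' (fun A 𝔭 x => hcompat h₁ h₂ h₃ h₄ A 𝔭 x) X 𝔭 x⟩

set_option backward.isDefEq.respectTransparency false in
/-- **[FrdI] Cor. 4.11 (iv) over `FrdI.T42.Setting` — THE data, with print's rigidity clause** ("by
concatenating assertions (ii), (iii), with the fact that `Ψ` preserves Frobenius degrees [cf. Theorem 3.4,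
(iii)] … the composite functors in this diagram are rigid … via the same argument as … (i)", p. 94): under
the hypotheses of `cor411iii_inst_of_setting` and `Cor411Setting` there are `Ψ^Base` (`1`-unique base
square), `η : Base₂ ∘ Ψ ≅ Ψ^Base ∘ Base₁`, and `Ψ^Φ : Φ₁ ⥲ Φ₂` on `D₁` over `Ψ^Base` such that `Ψ` preserves
Frobenius degrees and `Div(Ψ φ) = η_A^* Ψ^Φ(Div φ)` for EVERY arrow `φ : A → B` of `C₁` (the `1`-commutative
diagram `Ψ^F ∘ (C₁ → F_{Φ₁}) ≅ (C₂ → F_{Φ₂}) ∘ Ψ`), the typed rigidity clause `Cor411ivRigid` holds for this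
data, and for slim `D₁, D₂` the `D`-valued composites are rigid. [cite: MochizukiFrdI2008, Cor. 4.11 (iv) p.92] -/
theorem exists_cor411iv_data_of_setting (S : Setting F₁ F₂ Ψ)
    (hbfn₁ : ∀ A : C₁, IsBiratFrobeniusNormalized F₁ S.isFrobenioid₁
      (hasBiratSquares_of_isFrobenioid S.isFrobenioid₁) A)
    (hbfn₂ : ∀ A : C₂, IsBiratFrobeniusNormalized F₂ S.isFrobenioid₂
      (hasBiratSquares_of_isFrobenioid S.isFrobenioid₂) A)
    (Supp : ∀ {X : D₁}, (PreFrobenioidData.ofFunctor Φ₁ F₁).Mon X →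
      Primes ((PreFrobenioidData.ofFunctor Φ₁ F₁).Mon X) → Prop)
    (hSupp : ∀ (X : D₁) (a : Φ₁.obj (op X)) (𝔭 : Primes (Φ₁.obj (op X))),
      Supp a 𝔭 ↔ ∃ (a₀ : Φ₁.obj (op X)) (h₀ : IsPrimary a₀),
        Quotient.mk (primarySetoid _) ⟨a₀, h₀⟩ = 𝔭 ∧ Precsim a₀ a)
    (hrat : ∀ ⦃A : C₁⦄, PreFrobenioid.IsUniversallyDivFrobeniusTrivial F₁ A →
      PreFrobenioidData.IsRational (PreFrobenioid.biratData S.isFrobenioid₁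
        (PreFrobenioid.hasBiratSquares_of_isFrobenioid S.isFrobenioid₁)) Supp A)
    (hs : (PreFrobenioidData.ofFunctor Φ₁ F₁).Cor411Setting (PreFrobenioidData.ofFunctor Φ₂ F₂) Ψ) :
    ∃ (ΨBase : D₁ ⥤ D₂)
      (E' : (PreFrobenioidData.ofFunctor Φ₁ F₁).DivisorMonoidIsoOverBase (PreFrobenioidData.ofFunctor Φ₂ F₂) ΨBase)
      (η : Ψ.functor ⋙ (PreFrobenioidData.ofFunctor Φ₂ F₂).base ≅ (PreFrobenioidData.ofFunctor Φ₁ F₁).base ⋙ ΨBase),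
      PreFrobenioidData.OneUniqueSquare Ψ.functor (PreFrobenioidData.ofFunctor Φ₁ F₁).base (PreFrobenioidData.ofFunctor Φ₂ F₂).base ΨBase ∧
      PreFrobenioidData.PreservesDegFr (PreFrobenioidData.ofFunctor Φ₁ F₁) (PreFrobenioidData.ofFunctor Φ₂ F₂) Ψ ∧
      (∀ ⦃A B : C₁⦄ (φ : A ⟶ B),
        Div F₂ (Ψ.functor.map φ) = pull Φ₂ (η.hom.app A) (E'.iso (baseObj F₁ A) (Div F₁ φ))) ∧
      (PreFrobenioidData.ofFunctor Φ₁ F₁).Cor411ivRigid (PreFrobenioidData.ofFunctor Φ₂ F₂) Ψ ΨBase E' ∧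
      (IsSlim D₁ → IsSlim D₂ → IsRigidFunctor (Ψ.functor ⋙ (PreFrobenioidData.ofFunctor Φ₂ F₂).base) ∧
        IsRigidFunctor ((PreFrobenioidData.ofFunctor Φ₁ F₁).base ⋙ ΨBase)) := by
  obtain ⟨ΨBase, hsq, hrig⟩ := exists_baseSquare_of_setting S hbfn₁ hbfn₂ hs
  obtain ⟨η⟩ := hsq.2.1
  obtain ⟨E, e, -, hEdiv, -⟩ := FrdI.T49.exists_thm49_compat_perfect S
    (isNonDilatingOn_of_ofFunctor hs.standard.2.nonDilating) Supp hSupp hrat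
  have hdiv := E.iso_div_of_preSteps S.isFrobenioid₁ S.isFrobenioid₂ S.frobeniusType_map S.pullback_map hEdiv
  obtain ⟨E', hE'⟩ := E.exists_overBase ΨBase η (exists_base_iso_of_isFrobenioid F₁ S.isFrobenioid₁)
    (exists_preSteps_of_base_iso F₁ S.isFrobenioid₁) (fun A _ f => exists_arrow_over_base F₁ S.isFrobenioid₁ A f)
  have hdivE : ∀ ⦃A B : C₁⦄ (φ : A ⟶ B), (PreFrobenioidData.ofFunctor Φ₂ F₂).div (Ψ.functor.map φ) =
      (PreFrobenioidData.ofFunctor Φ₂ F₂).pull (η.hom.app A)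
        (E'.iso ((PreFrobenioidData.ofFunctor Φ₁ F₁).base.obj A) ((PreFrobenioidData.ofFunctor Φ₁ F₁).div φ)) := by
    intro A B φ
    rw [hE', ← (PreFrobenioidData.ofFunctor Φ₂ F₂).pull_comp, Iso.hom_inv_id_app,
      (PreFrobenioidData.ofFunctor Φ₂ F₂).pull_id]
    exact (hdiv φ).symm
  exact ⟨ΨBase, E', η, hsq, S.degFr_map, hdivE, cor411ivRigid_of_square F₁ F₂ Ψ S.isFrobenioid₂ ΨBase E' η hdivE,
    hrig⟩

/-- **[FrdI] Cor. 4.11 (iv) AS TYPED over `FrdI.T42.Setting`** (Category-theoreticity of the functor to an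
elementary Frobenioid I): under the hypotheses of `cor411iii_inst_of_setting`, the typed
`(ofFunctor Φ₁ F₁).Cor411iv (ofFunctor Φ₂ F₂) Ψ R₁ R₂` — `Ψ` carries `(Base, Div, deg_Fr)` of `C₁` to that of
`C₂` along `(Ψ^Base, Ψ^Φ)`, i.e. the `1`-commutative diagram `Ψ^F ∘ (C₁ → F_{Φ₁}) ≅ (C₂ → F_{Φ₂}) ∘ Ψ`
(p. 92). The parameters `R_i` are arbitrary. [cite: MochizukiFrdI2008, Cor. 4.11 (iv) p.92] -/
theorem cor411iv_inst_of_setting (S : Setting F₁ F₂ Ψ)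
    (hbfn₁ : ∀ A : C₁, IsBiratFrobeniusNormalized F₁ S.isFrobenioid₁
      (hasBiratSquares_of_isFrobenioid S.isFrobenioid₁) A)
    (hbfn₂ : ∀ A : C₂, IsBiratFrobeniusNormalized F₂ S.isFrobenioid₂
      (hasBiratSquares_of_isFrobenioid S.isFrobenioid₂) A)
    (Supp : ∀ {X : D₁}, (PreFrobenioidData.ofFunctor Φ₁ F₁).Mon X →
      Primes ((PreFrobenioidData.ofFunctor Φ₁ F₁).Mon X) → Prop)
    (hSupp : ∀ (X : D₁) (a : Φ₁.obj (op X)) (𝔭 : Primes (Φ₁.obj (op X))),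
      Supp a 𝔭 ↔ ∃ (a₀ : Φ₁.obj (op X)) (h₀ : IsPrimary a₀),
        Quotient.mk (primarySetoid _) ⟨a₀, h₀⟩ = 𝔭 ∧ Precsim a₀ a)
    (hrat : ∀ ⦃A : C₁⦄, PreFrobenioid.IsUniversallyDivFrobeniusTrivial F₁ A →
      PreFrobenioidData.IsRational (PreFrobenioid.biratData S.isFrobenioid₁
        (PreFrobenioid.hasBiratSquares_of_isFrobenioid S.isFrobenioid₁)) Supp A)
    (R₁ : (PreFrobenioidData.ofFunctor Φ₁ F₁).RSParams) (R₂ : (PreFrobenioidData.ofFunctor Φ₂ F₂).RSParams) :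
    (PreFrobenioidData.ofFunctor Φ₁ F₁).Cor411iv (PreFrobenioidData.ofFunctor Φ₂ F₂) Ψ R₁ R₂ := by
  intro hs hR₁ hR₂
  obtain ⟨E, e, -, hEdiv, -⟩ := FrdI.T49.exists_thm49_compat_perfect S
    (isNonDilatingOn_of_ofFunctor hs.standard.2.nonDilating) Supp hSupp hrat
  exact PreFrobenioidData.cor411iv_of_cor411ii _ _ Ψ R₁ R₂
    (exists_base_iso_of_isFrobenioid F₁ S.isFrobenioid₁) (exists_preSteps_of_base_iso F₁ S.isFrobenioid₁)
    (fun A _ f => exists_arrow_over_base F₁ S.isFrobenioid₁ A f)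
    (fun hs' => exists_baseSquare_of_setting S hbfn₁ hbfn₂ hs') E
    (E.iso_div_of_preSteps S.isFrobenioid₁ S.isFrobenioid₂ S.frobeniusType_map S.pullback_map hEdiv)
    S.degFr_map hs hR₁ hR₂

end FrdI.T42

end Literature.AlgebraicGeometry.Frobenioids
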